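import Mathlib
import Summits.Ventures.HodgeRepro2.A2TripleSumGysin

/-!
# A2 annex — linearity of the Poincaré dual and of the triple-sum class

Bookkeeping for `A2ModelDuality.dualOf` (the Poincaré dual of a functional) and
`A2TripleSumGysin.gysinTriple` (the class `y' = m₃_*(z₁ ⊗ z₂ ⊗ v)` of Corollary A8.2): `dualOf` is
linear (`dualOf_add`, `dualOf_smul`, `dualOf_zero`, `dualOf_neg`, `dualOf_sub`), hence `y'` is linear in
each functional (`gysinTriple_add_left`, `gysinTriple_smul_left`, …) — the multilinearity of
`m₃_*(z₁ ⊗ z₂ ⊗ v)` in `z₁, z₂, v` of (A4.3.1) in the model.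

Seat p6 (A2 owner), gen 16.  §8 (d): uses an L-value-free non-vanishing device: NO.
-/

namespace Summit.Ventures.HodgeRepro2.A2DualLinear

open WeilPlanes WeilIntegral WeilCoproduct A2TripleSumPairing A2ModelDuality A2TripleSumGysin
open scoped TensorProduct

variable {ι : Type*} [DecidableEq ι] [Fintype ι]

/-- `dualOf` is additive. -/
theorem dualOf_add (P Q : Module.Dual ℂ (A ι)) : dualOf (P + Q) = dualOf P + dualOf Q :=
  map_add (integralDualEquiv (ι := ι)).symm P Q

/-- `dualOf` commutes with scalars. -/
theorem dualOf_smul (r : ℂ) (P : Module.Dual ℂ (A ι)) : dualOf (r • P) = r • dualOf P :=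
  map_smul (integralDualEquiv (ι := ι)).symm r P

/-- `dualOf 0 = 0`. -/
theorem dualOf_zero : dualOf (0 : Module.Dual ℂ (A ι)) = 0 :=
  map_zero (integralDualEquiv (ι := ι)).symm

/-- `dualOf (−P) = −dualOf P`. -/
theorem dualOf_neg (P : Module.Dual ℂ (A ι)) : dualOf (-P) = -dualOf P :=
  map_neg (integralDualEquiv (ι := ι)).symm P

/-- `dualOf (P − Q) = dualOf P − dualOf Q`. -/
theorem dualOf_sub (P Q : Module.Dual ℂ (A ι)) : dualOf (P - Q) = dualOf P - dualOf Q :=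
  map_sub (integralDualEquiv (ι := ι)).symm P Q

/-- `dualOf` as a linear map. -/
noncomputable def dualOfLinear : Module.Dual ℂ (A ι) →ₗ[ℂ] A ι :=
  (integralDualEquiv (ι := ι)).symm.toLinearMap

/-- Unfolding `dualOfLinear`. -/
@[simp] theorem dualOfLinear_apply (P : Module.Dual ℂ (A ι)) : dualOfLinear P = dualOf P := rfl

omit [Fintype ι] in
/-- `pairTwo` is additive in the first functional. -/
theorem pairTwo_add_left (Φ₁ Φ₁' Φ₂ : A ι →ₗ[ℂ] ℂ) :
    pairTwo (Φ₁ + Φ₁') Φ₂ = pairTwo Φ₁ Φ₂ + pairTwo Φ₁' Φ₂ := by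
  refine LinearMap.ext fun Z => ?_
  induction Z using WeilCoproduct.AA_induction with
  | zero => simp
  | tmul x y => simp [pairTwo_tmul, add_mul]
  | add Z Z' hZ hZ' =>
    simp only [map_add, LinearMap.add_apply] at hZ hZ' ⊢
    rw [hZ, hZ']

omit [Fintype ι] in
/-- `pairTwo` commutes with scalars in the first functional. -/
theorem pairTwo_smul_left (r : ℂ) (Φ₁ Φ₂ : A ι →ₗ[ℂ] ℂ) :
    pairTwo (r • Φ₁) Φ₂ = r • pairTwo Φ₁ Φ₂ := by
  refine LinearMap.ext fun Z => ?_
  induction Z using WeilCoproduct.AA_induction with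
  | zero => simp
  | tmul x y => simp [pairTwo_tmul, mul_assoc]
  | add Z Z' hZ hZ' =>
    simp only [map_add, LinearMap.smul_apply] at hZ hZ' ⊢
    rw [hZ, hZ']

omit [Fintype ι] in
/-- `pairThreeAux` is additive in the first functional. -/
theorem pairThreeAux_add_left (Φ₁ Φ₁' Φ₂ Ψ : A ι →ₗ[ℂ] ℂ) :
    pairThreeAux (Φ₁ + Φ₁') Φ₂ Ψ = pairThreeAux Φ₁ Φ₂ Ψ + pairThreeAux Φ₁' Φ₂ Ψ := by
  refine LinearMap.ext fun Z => ?_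
  induction Z using WeilCoproduct.AA_induction with
  | zero => simp
  | tmul x y => simp [pairThreeAux_tmul, pairTwo_add_left, add_mul]
  | add Z Z' hZ hZ' =>
    simp only [map_add, LinearMap.add_apply] at hZ hZ' ⊢
    rw [hZ, hZ']

omit [Fintype ι] in
/-- `pairThreeAux` commutes with scalars in the first functional. -/
theorem pairThreeAux_smul_left (r : ℂ) (Φ₁ Φ₂ Ψ : A ι →ₗ[ℂ] ℂ) :
    pairThreeAux (r • Φ₁) Φ₂ Ψ = r • pairThreeAux Φ₁ Φ₂ Ψ := by
  refine LinearMap.ext fun Z => ?_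
  induction Z using WeilCoproduct.AA_induction with
  | zero => simp
  | tmul x y => simp [pairThreeAux_tmul, pairTwo_smul_left, mul_assoc]
  | add Z Z' hZ hZ' =>
    simp only [map_add, LinearMap.smul_apply] at hZ hZ' ⊢
    rw [hZ, hZ']

omit [Fintype ι] in
/-- `pairThree` is additive in the first functional. -/
theorem pairThree_add_left (Φ₁ Φ₁' Φ₂ Ψ : A ι →ₗ[ℂ] ℂ) :
    pairThree (Φ₁ + Φ₁') Φ₂ Ψ = pairThree Φ₁ Φ₂ Ψ + pairThree Φ₁' Φ₂ Ψ := by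
  refine LinearMap.ext fun u => ?_
  rw [LinearMap.add_apply, pairThree_apply, pairThree_apply, pairThree_apply,
    pairThreeAux_add_left, LinearMap.add_apply]

omit [Fintype ι] in
/-- `pairThree` commutes with scalars in the first functional. -/
theorem pairThree_smul_left (r : ℂ) (Φ₁ Φ₂ Ψ : A ι →ₗ[ℂ] ℂ) :
    pairThree (r • Φ₁) Φ₂ Ψ = r • pairThree Φ₁ Φ₂ Ψ := by
  refine LinearMap.ext fun u => ?_
  rw [LinearMap.smul_apply, pairThree_apply, pairThree_apply, pairThreeAux_smul_left,
    LinearMap.smul_apply]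

/-- The class `y'` is additive in the first functional (`m₃_*` is linear in `z₁`). -/
theorem gysinTriple_add_left (Φ₁ Φ₁' Φ₂ Ψ : A ι →ₗ[ℂ] ℂ) :
    gysinTriple (Φ₁ + Φ₁') Φ₂ Ψ = gysinTriple Φ₁ Φ₂ Ψ + gysinTriple Φ₁' Φ₂ Ψ := by
  rw [gysinTriple, gysinTriple, gysinTriple, pairThree_add_left, dualOf_add]

/-- The class `y'` commutes with scalars in the first functional. -/
theorem gysinTriple_smul_left (r : ℂ) (Φ₁ Φ₂ Ψ : A ι →ₗ[ℂ] ℂ) :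
    gysinTriple (r • Φ₁) Φ₂ Ψ = r • gysinTriple Φ₁ Φ₂ Ψ := by
  rw [gysinTriple, gysinTriple, pairThree_smul_left, dualOf_smul]

end Summit.Ventures.HodgeRepro2.A2DualLinear
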